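import Summits.Ventures.LatticeQCDFlow.Exactness.FlowSamplerPositive
import Summits.Ventures.LatticeQCDFlow.Exactness.FlowSamplerAutocorrelation
import Summits.Ventures.LatticeQCDFlow.Scoring.CalibrationTruths
import HarnessLib

/-!
# Nonnegative, LOG-CONVEX autocovariances of the flow sampler; `ρ(n) ≥ ρ(1)ⁿ`; the `τ_int` floor

HONEST FRAMING: exact (Metropolis-corrected) sampling algorithms for lattice gauge theory;
figures of merit are autocorrelation/cost numbers at stated couplings and volumes; no
continuum-physics claim.  (SCALAR calibration rung S0-A: not a gauge result.)

Venture `LatticeQCDFlow` (cell pub-lqcd), topic `Exactness`; FANOUT row 2 (`s0-phi4`, FLOW arm).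
NEW WORK of the cell, composing `Exactness/FlowSamplerPositive.lean` (`K = imhOp μ w q` is a
positive operator on `L²(w dμ)`), row 2's self-adjointness `imh_integral_symm`
(`Phi4IndependenceSamplerReversible.lean`) and the cell's `τ_int` vocabulary
(`Scoring/CalibrationTruths.lean`: `tauInt ρ = ½ + Σ_{t≥1} ρ t`, `tauIntWindow`).  Nothing is
cited as a fact.  Printed counterparts, NAMED ONLY: Madras–Slade 1993, *The Self-Avoiding Walk*,
Prop. 9.2.2 p. 304 (`τ_int,g ≥ ½(1 + ρ_g(1))/(1 − ρ_g(1))` for reversible finite chains, via the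
spectral theorem); Liu 1996 (independence sampler).  Here: general measure space, NO spectral
theorem — two Cauchy–Schwarz inequalities (in `L²(w)` and for the positive `K`-form) give
log-convexity of the autocovariance sequence, which is what the floor needs.

## What is proved (general `(X, μ)`; `w > 0` integrable, `q > 0`, `∫ q = 1`; `g` bounded
measurable; `C(n) = ∫ g (Kⁿ g) w dμ`)

* §3 `integral_imhOp_mul_mul_comm` (`∫ (K g) h w = ∫ g (K h) w`, the named form of row 2's
  reversibility), `imhOp_add_mul` (linearity), `imhOp_iterate_bdd`,
  `integral_iterate_mul_iterate` (`∫ (Kᵐ g)(Kᵏ g) w = C(m + k)`), **`autocov_nonneg`**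
  (`0 ≤ C(n)` for EVERY `n`: even lags are squares, odd lags are `⟨h, K h⟩ ≥ 0`), `kform_sq_le`
  (Cauchy–Schwarz for `(x, y) ↦ ∫ x (K y) w` by the discriminant of `l ↦ ⟨x + l y, K(x + l y)⟩ ≥ 0`),
  **`autocov_logConvex`** (`C(n+1)² ≤ C(n) C(n+2)`);
* §4 (real sequences) `logConvex_ratio_step`, `logConvex_geometric_le`, `logConvex_ratio_pow_le`
  (a nonnegative log-convex sequence dominates the geometric one through its first two terms:
  `(a₁/a₀)^(n+1) ≤ a(n+1)/a₀`), `tauIntWindow_mono_of_nonneg`, `tauIntWindow_le_tauInt_of_nonneg`,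
  `tauIntWindow_geometric_le`, `geomTauInt_mono`, and **`tauInt_ge_of_pow_le`**: a summable `ρ`
  with `ρ(n) ≥ ρ(1)ⁿ ≥ 0` has `ρ(1) < 1` and `τ_int ≥ (1 + ρ(1))/(2(1 − ρ(1)))`.

The sampler-level statements (`ρ(n) ≥ ρ(1)ⁿ`, monotone windows, the floor, the rejection floor,
the two-sided sandwich under a weight bound, and row 2's lattice instances) are in
`Exactness/FlowSamplerTauIntFloor.lean`.  NOT CLAIMED: HMC / local Metropolis; unbounded
observables; numbers for any trained network.
-/

namespace Summit.Ventures.LatticeQCDFlow.Exactness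

open Real MeasureTheory Filter Finset Set
open Summit.Ventures.LatticeQCDFlow.Scoring

section General

variable {X : Type*} [MeasurableSpace X] {μ : Measure X} [SFinite μ] {w q : X → ℝ}

/-! ## §3 Self-adjointness, linearity, iterates: all autocovariances are `≥ 0` and log-convex -/

/-- Self-adjointness for the named operator (row 2's `imh_integral_symm`):
`∫ (K g) h w = ∫ g (K h) w`. -/
theorem integral_imhOp_mul_mul_comm (hw0 : ∀ t, 0 < w t) (hwm : Measurable w)
    (hwi : Integrable w μ) (hq0 : ∀ t, 0 < q t) (hqm : Measurable q) (hqi : Integrable q μ)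
    {g h : X → ℝ} (hgm : Measurable g) (hhm : Measurable h) {Bg Bh : ℝ} (hgb : ∀ t, |g t| ≤ Bg)
    (hhb : ∀ t, |h t| ≤ Bh) :
    ∫ t, imhOp μ w q g t * h t * w t ∂μ = ∫ t, g t * imhOp μ w q h t * w t ∂μ := by
  unfold imhOp imhAcceptQ
  exact imh_integral_symm hw0 hwm hwi hq0 hqm hqi hgm hhm hgb hhb

omit [SFinite μ] in
/-- `K` is linear: `K (g + l·h) = K g + l·K h`. -/
theorem imhOp_add_mul (hw0 : ∀ t, 0 < w t) (hwm : Measurable w) (hq0 : ∀ t, 0 < q t)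
    (hqm : Measurable q) (hqi : Integrable q μ) {g h : X → ℝ} (hgm : Measurable g)
    (hhm : Measurable h) {Bg Bh : ℝ} (hgb : ∀ t, |g t| ≤ Bg) (hhb : ∀ t, |h t| ≤ Bh) (l : ℝ)
    (t : X) :
    imhOp μ w q (fun s => g s + l * h s) t = imhOp μ w q g t + l * imhOp μ w q h t := by
  unfold imhOp
  have hIg := integrable_imhOp_integrand hw0 hwm hq0 hqm hqi hgm hgb t
  have hIh := integrable_imhOp_integrand hw0 hwm hq0 hqm hqi hhm hhb t
  have e : ∀ t', (imhAcceptQ w q t t' * (g t' + l * h t')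
      + (1 - imhAcceptQ w q t t') * (g t + l * h t)) * q t'
      = (imhAcceptQ w q t t' * g t' + (1 - imhAcceptQ w q t t') * g t) * q t'
        + l * ((imhAcceptQ w q t t' * h t' + (1 - imhAcceptQ w q t t') * h t) * q t') :=
    fun t' => by ring
  simp_rw [e]
  rw [integral_add hIg (hIh.const_mul l), integral_const_mul]

/-- Iterates of `K` on a bounded measurable observable stay measurable and bounded. -/
theorem imhOp_iterate_bdd (hw0 : ∀ t, 0 < w t) (hwm : Measurable w) (hq0 : ∀ t, 0 < q t)
    (hqm : Measurable q) (hqi : Integrable q μ) (hq1 : ∫ t, q t ∂μ = 1) {B : ℝ} :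
    ∀ (n : ℕ) {g : X → ℝ}, Measurable g → (∀ t, |g t| ≤ B) →
      Measurable ((imhOp μ w q)^[n] g) ∧ ∀ t, |((imhOp μ w q)^[n] g) t| ≤ B
  | 0, g, hgm, hgb => by simpa using ⟨hgm, hgb⟩
  | n + 1, g, hgm, hgb => by
    rw [Function.iterate_succ_apply]
    exact imhOp_iterate_bdd hw0 hwm hq0 hqm hqi hq1 n (measurable_imhOp hwm hqm hgm)
      (imhOp_abs_le hw0 hq0 hqi hq1 hgb)

/-- **Two-time form**: `∫ (Kᵐ g)(Kᵏ g) w = ∫ g (K^{m+k} g) w` (self-adjointness, iterated). -/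
theorem integral_iterate_mul_iterate (hw0 : ∀ t, 0 < w t) (hwm : Measurable w)
    (hwi : Integrable w μ) (hq0 : ∀ t, 0 < q t) (hqm : Measurable q) (hqi : Integrable q μ)
    (hq1 : ∫ t, q t ∂μ = 1) {g : X → ℝ} (hgm : Measurable g) {B : ℝ} (hgb : ∀ t, |g t| ≤ B) :
    ∀ m k : ℕ, ∫ t, ((imhOp μ w q)^[m] g) t * ((imhOp μ w q)^[k] g) t * w t ∂μ
      = ∫ t, g t * ((imhOp μ w q)^[m + k] g) t * w t ∂μ
  | 0, k => by simp
  | m + 1, k => by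
    obtain ⟨hmm, hmb⟩ := imhOp_iterate_bdd (μ := μ) hw0 hwm hq0 hqm hqi hq1 m hgm hgb
    obtain ⟨hkm, hkb⟩ := imhOp_iterate_bdd (μ := μ) hw0 hwm hq0 hqm hqi hq1 k hgm hgb
    rw [Function.iterate_succ_apply' (imhOp μ w q) m g,
      integral_imhOp_mul_mul_comm hw0 hwm hwi hq0 hqm hqi hmm hkm hmb hkb,
      ← Function.iterate_succ_apply' (imhOp μ w q) k g,
      integral_iterate_mul_iterate hw0 hwm hwi hq0 hqm hqi hq1 hgm hgb m (k + 1),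
      Nat.add_right_comm m 1 k, Nat.add_assoc]

/-- **EVERY STATIONARY AUTOCOVARIANCE IS NONNEGATIVE**: `0 ≤ ∫ g (Kⁿ g) w dμ` for every bounded
measurable `g` and every lag `n` (even lags are squares, odd lags are `⟨h, K h⟩ ≥ 0`). -/
theorem autocov_nonneg (hw0 : ∀ t, 0 < w t) (hwm : Measurable w) (hwi : Integrable w μ)
    (hq0 : ∀ t, 0 < q t) (hqm : Measurable q) (hqi : Integrable q μ) (hq1 : ∫ t, q t ∂μ = 1)
    {g : X → ℝ} (hgm : Measurable g) {B : ℝ} (hgb : ∀ t, |g t| ≤ B) (n : ℕ) :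
    0 ≤ ∫ t, g t * ((imhOp μ w q)^[n] g) t * w t ∂μ := by
  obtain ⟨s, rfl | rfl⟩ := Nat.even_or_odd' n
  · rw [two_mul, ← integral_iterate_mul_iterate hw0 hwm hwi hq0 hqm hqi hq1 hgm hgb s s]
    exact integral_nonneg fun t => mul_nonneg (mul_self_nonneg _) (hw0 t).le
  · obtain ⟨hsm, hsb⟩ := imhOp_iterate_bdd (μ := μ) hw0 hwm hq0 hqm hqi hq1 s hgm hgb
    rw [show 2 * s + 1 = s + (s + 1) by ring,
      ← integral_iterate_mul_iterate hw0 hwm hwi hq0 hqm hqi hq1 hgm hgb s (s + 1),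
      Function.iterate_succ_apply' (imhOp μ w q) s g]
    exact integral_mul_imhOp_mul_nonneg hw0 hwm hwi hq0 hqm hqi hq1 hsm hsb

/-- **Cauchy–Schwarz for the `K`-form**: `(∫ x (K y) w)² ≤ (∫ x (K x) w)(∫ y (K y) w)` — the
positive symmetric bilinear form `(x, y) ↦ ⟨x, K y⟩_w` (discriminant of `l ↦ ⟨x + l y, K(x + l y)⟩`). -/
theorem kform_sq_le (hw0 : ∀ t, 0 < w t) (hwm : Measurable w) (hwi : Integrable w μ)
    (hq0 : ∀ t, 0 < q t) (hqm : Measurable q) (hqi : Integrable q μ) (hq1 : ∫ t, q t ∂μ = 1)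
    {x y : X → ℝ} (hxm : Measurable x) (hym : Measurable y) {Bx By : ℝ} (hxb : ∀ t, |x t| ≤ Bx)
    (hyb : ∀ t, |y t| ≤ By) :
    (∫ t, x t * imhOp μ w q y t * w t ∂μ) ^ 2
      ≤ (∫ t, x t * imhOp μ w q x t * w t ∂μ) * ∫ t, y t * imhOp μ w q y t * w t ∂μ := by
  have hKxm := measurable_imhOp (μ := μ) hwm hqm hxm
  have hKym := measurable_imhOp (μ := μ) hwm hqm hym
  have hKxb := imhOp_abs_le (μ := μ) hw0 hq0 hqi hq1 hxb
  have hKyb := imhOp_abs_le (μ := μ) hw0 hq0 hqi hq1 hyb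
  have hsym : ∫ t, y t * imhOp μ w q x t * w t ∂μ = ∫ t, x t * imhOp μ w q y t * w t ∂μ := by
    rw [← integral_imhOp_mul_mul_comm hw0 hwm hwi hq0 hqm hqi hxm hym hxb hyb]
    refine integral_congr_ae (Eventually.of_forall fun t => ?_)
    dsimp only
    ring
  have hquad : ∀ l : ℝ, 0 ≤ (∫ t, y t * imhOp μ w q y t * w t ∂μ) * (l * l)
      + (2 * ∫ t, x t * imhOp μ w q y t * w t ∂μ) * l + ∫ t, x t * imhOp μ w q x t * w t ∂μ := by
    intro l
    have hzm : Measurable fun s => x s + l * y s := hxm.add (measurable_const.mul hym)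
    have hzb : ∀ s, |x s + l * y s| ≤ Bx + |l| * By := fun s => by
      calc |x s + l * y s| ≤ |x s| + |l * y s| := abs_add_le _ _
        _ ≤ Bx + |l| * By := by
            rw [abs_mul]; exact add_le_add (hxb s) (mul_le_mul_of_nonneg_left (hyb s) (abs_nonneg l))
    have h0 := integral_mul_imhOp_mul_nonneg hw0 hwm hwi hq0 hqm hqi hq1 hzm hzb
    have e : ∫ t, (x t + l * y t) * imhOp μ w q (fun s => x s + l * y s) t * w t ∂μ
        = (∫ t, x t * imhOp μ w q x t * w t ∂μ) + l * (∫ t, x t * imhOp μ w q y t * w t ∂μ)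
          + l * (∫ t, y t * imhOp μ w q x t * w t ∂μ)
          + l * l * ∫ t, y t * imhOp μ w q y t * w t ∂μ := by
      have e1 : ∀ t, (x t + l * y t) * imhOp μ w q (fun s => x s + l * y s) t * w t
          = x t * imhOp μ w q x t * w t + l * (x t * imhOp μ w q y t * w t)
            + l * (y t * imhOp μ w q x t * w t) + l * l * (y t * imhOp μ w q y t * w t) := by
        intro t
        rw [imhOp_add_mul hw0 hwm hq0 hqm hqi hxm hym hxb hyb l t]
        ring
      simp_rw [e1]
      have i1 : Integrable (fun t => x t * imhOp μ w q x t * w t) μ :=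
        integrable_mul_mul_weight hw0 hwm hwi hxm hKxm hxb hKxb
      have i2 : Integrable (fun t => l * (x t * imhOp μ w q y t * w t)) μ :=
        (integrable_mul_mul_weight hw0 hwm hwi hxm hKym hxb hKyb).const_mul l
      have i3 : Integrable (fun t => l * (y t * imhOp μ w q x t * w t)) μ :=
        (integrable_mul_mul_weight hw0 hwm hwi hym hKxm hyb hKxb).const_mul l
      have i4 : Integrable (fun t => l * l * (y t * imhOp μ w q y t * w t)) μ :=
        (integrable_mul_mul_weight hw0 hwm hwi hym hKym hyb hKyb).const_mul (l * l)
      have i12 : Integrable (fun t => x t * imhOp μ w q x t * w t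
          + l * (x t * imhOp μ w q y t * w t)) μ := i1.add i2
      have i123 : Integrable (fun t => x t * imhOp μ w q x t * w t
          + l * (x t * imhOp μ w q y t * w t) + l * (y t * imhOp μ w q x t * w t)) μ := i12.add i3
      rw [integral_add i123 i4, integral_add i12 i3, integral_add i1 i2,
        integral_const_mul, integral_const_mul, integral_const_mul]
    rw [e, hsym] at h0
    nlinarith
  have hd := discrim_le_zero hquad
  rw [discrim] at hd
  nlinarith

/-- **THE AUTOCOVARIANCE SEQUENCE IS LOG-CONVEX**: `C(n+1)² ≤ C(n) C(n+2)` for every `n`, where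
`C(n) = ∫ g (Kⁿ g) w dμ` (even `n`: Cauchy–Schwarz in `L²(w)`; odd `n`: Cauchy–Schwarz for the
`K`-form). -/
theorem autocov_logConvex (hw0 : ∀ t, 0 < w t) (hwm : Measurable w) (hwi : Integrable w μ)
    (hq0 : ∀ t, 0 < q t) (hqm : Measurable q) (hqi : Integrable q μ) (hq1 : ∫ t, q t ∂μ = 1)
    {g : X → ℝ} (hgm : Measurable g) {B : ℝ} (hgb : ∀ t, |g t| ≤ B) (n : ℕ) :
    (∫ t, g t * ((imhOp μ w q)^[n + 1] g) t * w t ∂μ) ^ 2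
      ≤ (∫ t, g t * ((imhOp μ w q)^[n] g) t * w t ∂μ)
        * ∫ t, g t * ((imhOp μ w q)^[n + 2] g) t * w t ∂μ := by
  have two := integral_iterate_mul_iterate hw0 hwm hwi hq0 hqm hqi hq1 hgm hgb
  obtain ⟨s, rfl | rfl⟩ := Nat.even_or_odd' n
  · -- `C(2s+1)² ≤ C(2s) C(2s+2)`: plain Cauchy–Schwarz with `Kˢg`, `K^{s+1}g`
    obtain ⟨h1m, h1b⟩ := imhOp_iterate_bdd (μ := μ) hw0 hwm hq0 hqm hqi hq1 s hgm hgb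
    obtain ⟨h2m, h2b⟩ := imhOp_iterate_bdd (μ := μ) hw0 hwm hq0 hqm hqi hq1 (s + 1) hgm hgb
    have hA := two s (s + 1)
    have hB := two s s
    have hC := two (s + 1) (s + 1)
    rw [show s + (s + 1) = 2 * s + 1 by ring] at hA
    rw [show s + s = 2 * s by ring] at hB
    rw [show s + 1 + (s + 1) = 2 * s + 2 by ring] at hC
    rw [← hA, ← hB, ← hC]
    have h := sq_integral_mul_mul_le hw0 hwm hwi h1m h2m h1b h2b
    simp only [sq] at h ⊢
    exact h
  · -- `C(2s+2)² ≤ C(2s+1) C(2s+3)`: Cauchy–Schwarz for the `K`-form with `Kˢg`, `K(Kˢg)`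
    obtain ⟨h1m, h1b⟩ := imhOp_iterate_bdd (μ := μ) hw0 hwm hq0 hqm hqi hq1 s hgm hgb
    have h2m := measurable_imhOp (μ := μ) hwm hqm h1m
    have h2b := imhOp_abs_le (μ := μ) hw0 hq0 hqi hq1 h1b
    have hA := two s (s + 1 + 1)
    have hB := two s (s + 1)
    have hC := two (s + 1) (s + 1 + 1)
    rw [show s + (s + 1 + 1) = 2 * s + 1 + 1 by ring] at hA
    rw [show s + (s + 1) = 2 * s + 1 by ring] at hB
    rw [show s + 1 + (s + 1 + 1) = 2 * s + 1 + 2 by ring] at hC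
    rw [← hA, ← hB, ← hC, Function.iterate_succ_apply' (imhOp μ w q) (s + 1) g,
      Function.iterate_succ_apply' (imhOp μ w q) s g]
    exact kform_sq_le hw0 hwm hwi hq0 hqm hqi hq1 h1m h2m h1b h2b

/-! ## §4 Consequences: `ρ(n) ≥ ρ(1)ⁿ ≥ 0`, monotone windows, `τ_int ≥ (1 + ρ₁)/(2(1 − ρ₁))` -/

end General

section Sequences

/-- A nonnegative log-convex sequence has nondecreasing ratios: `a(n)·a(1) ≤ a(n+1)·a(0)`
(zeros included: if some `a(n+1) = 0` the claim is trivial, otherwise `a(n) > 0`). -/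
theorem logConvex_ratio_step {a : ℕ → ℝ} (h0 : ∀ n, 0 ≤ a n)
    (hlc : ∀ n, a (n + 1) ^ 2 ≤ a n * a (n + 2)) : ∀ n, a n * a 1 ≤ a (n + 1) * a 0
  | 0 => by rw [mul_comm]
  | n + 1 => by
    have ih := logConvex_ratio_step h0 hlc n
    have hc := hlc n
    rcases eq_or_lt_of_le (h0 (n + 1)) with hz | hpos
    · rw [← hz, zero_mul]
      exact mul_nonneg (h0 _) (h0 _)
    · have hn : 0 < a n := by
        rcases eq_or_lt_of_le (h0 n) with hz | hp
        · rw [← hz, zero_mul] at hc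
          nlinarith
        · exact hp
      have key : a n * (a (n + 1) * a 1) ≤ a n * (a (n + 2) * a 0) := by
        calc a n * (a (n + 1) * a 1) = a (n + 1) * (a n * a 1) := by ring
          _ ≤ a (n + 1) * (a (n + 1) * a 0) := mul_le_mul_of_nonneg_left ih (h0 _)
          _ = a (n + 1) ^ 2 * a 0 := by ring
          _ ≤ a n * a (n + 2) * a 0 := mul_le_mul_of_nonneg_right hc (h0 0)
          _ = a n * (a (n + 2) * a 0) := by ring
      exact le_of_mul_le_mul_left key hn

/-- A nonnegative log-convex sequence dominates the geometric sequence through its first two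
terms: `a(1)ⁿ · a(0) ≤ a(n) · a(0)ⁿ`. -/
theorem logConvex_geometric_le {a : ℕ → ℝ} (h0 : ∀ n, 0 ≤ a n)
    (hlc : ∀ n, a (n + 1) ^ 2 ≤ a n * a (n + 2)) : ∀ n, a 1 ^ n * a 0 ≤ a n * a 0 ^ n
  | 0 => by simp
  | n + 1 => by
    have ih := logConvex_geometric_le h0 hlc n
    have st := logConvex_ratio_step h0 hlc n
    calc a 1 ^ (n + 1) * a 0 = a 1 * (a 1 ^ n * a 0) := by ring
      _ ≤ a 1 * (a n * a 0 ^ n) := mul_le_mul_of_nonneg_left ih (h0 1)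
      _ = a n * a 1 * a 0 ^ n := by ring
      _ ≤ a (n + 1) * a 0 * a 0 ^ n := mul_le_mul_of_nonneg_right st (pow_nonneg (h0 0) n)
      _ = a (n + 1) * a 0 ^ (n + 1) := by ring

/-- Normalised form: `(a(1)/a(0))^(n+1) ≤ a(n+1)/a(0)` (Lean's `x/0 = 0` covers `a(0) = 0`). -/
theorem logConvex_ratio_pow_le {a : ℕ → ℝ} (h0 : ∀ n, 0 ≤ a n)
    (hlc : ∀ n, a (n + 1) ^ 2 ≤ a n * a (n + 2)) (n : ℕ) :
    (a 1 / a 0) ^ (n + 1) ≤ a (n + 1) / a 0 := by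
  rcases eq_or_lt_of_le (h0 0) with hz | hpos
  · rw [← hz, div_zero, div_zero, zero_pow (Nat.succ_ne_zero n)]
  · rw [div_pow, div_le_div_iff₀ (pow_pos hpos _) hpos]
    exact logConvex_geometric_le h0 hlc (n + 1)

/-- Windows of a NONNEGATIVE autocorrelation sequence are monotone in the window … -/
theorem tauIntWindow_mono_of_nonneg {ρ : ℕ → ℝ} (h : ∀ n, 0 ≤ ρ (n + 1)) :
    Monotone (tauIntWindow ρ) := by
  intro W W' hWW'
  unfold tauIntWindow
  have hs := Finset.sum_le_sum_of_subset_of_nonneg (f := fun t => ρ (t + 1))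
    (Finset.range_mono hWW') fun t _ _ => h t
  linarith

/-- … and lie BELOW `τ_int` whenever the series is summable: windowing under-estimates. -/
theorem tauIntWindow_le_tauInt_of_nonneg {ρ : ℕ → ℝ} (h : ∀ n, 0 ≤ ρ (n + 1))
    (hs : Summable fun t => ρ (t + 1)) (W : ℕ) : tauIntWindow ρ W ≤ tauInt ρ := by
  unfold tauIntWindow tauInt
  have h' := hs.sum_le_tsum (Finset.range W) fun t _ => h t
  linarith

/-- Geometric floor under every window: `τ_W(ρ₁ᵗ) ≤ τ_W(ρ)` when `ρ₁^t ≤ ρ(t)`. -/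
theorem tauIntWindow_geometric_le {ρ : ℕ → ℝ} (hpow : ∀ n, ρ 1 ^ (n + 1) ≤ ρ (n + 1)) (W : ℕ) :
    tauIntWindow (fun t => ρ 1 ^ t) W ≤ tauIntWindow ρ W := by
  unfold tauIntWindow
  have h' : ∑ t ∈ Finset.range W, ρ 1 ^ (t + 1) ≤ ∑ t ∈ Finset.range W, ρ (t + 1) :=
    Finset.sum_le_sum fun t _ => hpow t
  linarith

/-- `x ↦ (1 + x)/(2(1 − x))` is monotone below `1`. -/
theorem geomTauInt_mono {x y : ℝ} (hxy : x ≤ y) (hy : y < 1) :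
    (1 + x) / (2 * (1 - x)) ≤ (1 + y) / (2 * (1 - y)) := by
  rw [div_le_div_iff₀ (by linarith) (by linarith)]
  nlinarith

/-- **`τ_int ≥ (1 + ρ₁)/(2(1 − ρ₁))`** for a summable autocorrelation sequence dominating the
geometric sequence `ρ₁ᵗ` (`ρ₁ ≥ 0`); summability forces `ρ₁ < 1`. -/
theorem tauInt_ge_of_pow_le {ρ : ℕ → ℝ} (h1 : 0 ≤ ρ 1) (hpow : ∀ n, ρ 1 ^ (n + 1) ≤ ρ (n + 1))
    (hs : Summable fun t => ρ (t + 1)) :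
    ρ 1 < 1 ∧ (1 + ρ 1) / (2 * (1 - ρ 1)) ≤ tauInt ρ := by
  have hlt : ρ 1 < 1 := by
    rcases lt_or_ge (ρ 1) 1 with hlt | hge
    · exact hlt
    · exfalso
      obtain ⟨N, hN⟩ :=
        (hs.tendsto_atTop_zero.eventually (eventually_lt_nhds one_half_pos)).exists
      have hp := hpow N
      have h1le : (1 : ℝ) ≤ ρ 1 ^ (N + 1) := one_le_pow₀ hge
      linarith
  refine ⟨hlt, ?_⟩
  have habs : |ρ 1| < 1 := by rw [abs_of_nonneg h1]; exact hlt
  have hgeo := hasSum_geometric_succ habs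
  have hle : ∑' t, ρ 1 ^ (t + 1) ≤ ∑' t, ρ (t + 1) := hgeo.summable.tsum_le_tsum hpow hs
  rw [hgeo.tsum_eq] at hle
  have e : (1 + ρ 1) / (2 * (1 - ρ 1)) = 1 / 2 + ρ 1 / (1 - ρ 1) := by
    have h1r : 1 - ρ 1 ≠ 0 := by linarith
    field_simp
    ring
  unfold tauInt
  rw [e]
  linarith

end Sequences

end Summit.Ventures.LatticeQCDFlow.Exactness
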